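import Summits.AtomisticToContinuum.FouriersLaw.Theorems.BondHeatUncertaintySubdiffusiveBondHeatKernelGibbsC
import Literature.MathematicalPhysics.KineticTheory.SdeGeneratorCalculus

/-!
# Towards kernel detailed balance (H2): the Doob `e^{-H/T}`-transform of the anti-friction generator is the momentum-flipped generator

Support for the registered stub `stub_kernelDetailedBalance` (label (H2)) of crux `stmt-AtomisticToContinuum-9120`
(`BondHeatUncertainty.SubdiffusiveBondHeat`, line `bath-bond-deficit-integral`; see `Cruxes/SubdiffusiveBondHeat/DetailedBalanceAnalysis.md`):
(H2) `∫ f·(P_s h) dμ_T = ∫ (h∘Θ)·P_s(f∘Θ) dμ_T` is, by the Lebesgue duality of `LangevinChainReversal` and the eigen-relation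
`P̂_t e^{-H/T} = e^{-2γt}e^{-H/T}` (`…KernelGibbsC`), equivalent to the identification of the Markov semigroup
`P̃_t f = e^{2γt} ρ⁻¹ P̂_t(ρ f)` (`ρ = e^{-H/T}`, `P̂` the anti-friction reversed kernels) with the momentum-flipped forward
semigroup `f ↦ (P_t (f∘Θ))∘Θ`. This file proves the GENERATOR-LEVEL identity behind it (Rey-Bellet 2006, Lemma 4.2 at equal
temperatures, "`J L† J = L` as operator identities on `C^∞` functions"):

* `drift_flip`, `flip_drift_flip` — `Θ Y(Θx) = -Y(x) - 2γ(0, 1_B p)`;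
* `sdeGenerator_flip_conj` — `(L(g∘Θ))(Θx) = L̂ g(x) - 2γ Σ_b p_b ∂_{p_b} g(x)` (`L̂ = sdeGenerator (-Y)`), any `C²` chain;
* `revGenerator_gibbsDensity_mul` — `L̂(ρ f) = ρ (L̂ f - 2γ Σ_b p_b ∂_{p_b} f) - 2γ ρ f` at `T_L = T_R = T` (product rule, carré du
  champ `Γ(ρ,f) = -2γρ Σ_b p_b ∂_{p_b} f`, `L̂ρ = -2γρ`);
* `revGenerator_gibbsDensity_mul_eq_flip` — hence `ρ⁻¹ L̂(ρ f) + 2γ f = (L (f∘Θ))∘Θ` pointwise.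
Nothing here closes the stub: the remaining step is a UNIQUENESS statement for Markov semigroups with a common Dynkin
identity on `C_c^∞` (Girsanov h-transform, or essential m-dissipativity + C₀-semigroup uniqueness), absent from the tree.
-/

noncomputable section

open MeasureTheory Filter Topology Set
open scoped NNReal
open ProbabilityTheory

namespace Summit.AtomisticToContinuum.FouriersLaw.Theorems.SubdiffusiveBondHeat

open Literature.MathematicalPhysics.KineticTheory.HeatConduction
open Literature.MathematicalPhysics.KineticTheory OscillatorChain

variable (P : OscillatorChain) {N : ℕ}

/-! ### The momentum flip and the drift -/

/-- `∂_{q_i} H` is even in the momenta. [folklore] -/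
theorem partialQ_hamiltonian_flip (x : PhaseSpace N) (i : Fin N) :
    partialQ i (P.hamiltonian N) (x.1, -x.2) = partialQ i (P.hamiltonian N) x := by
  rw [P.partialQ_hamiltonian_eq, P.partialQ_hamiltonian_eq]

/-- The drift at the flipped point: `Y(q,-p) = (-p, -∇Φ(q) + γ 1_B p)`. [folklore] -/
theorem drift_flip (x : PhaseSpace N) :
    P.drift N (x.1, -x.2) = (-x.2, fun i => -partialQ i (P.hamiltonian N) x + P.γ * bathWeight N i * x.2 i) := by
  ext i
  · simp [OscillatorChain.drift]
  · simp only [OscillatorChain.drift, partialQ_hamiltonian_flip, Pi.neg_apply]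
    ring

/-- **`Θ Y(Θ x) = -Y(x) - 2γ (0, 1_B p)`**: conjugating the Langevin drift by the momentum flip gives the ANTI-FRICTION
reversed drift up to twice the friction. [folklore] -/
theorem flip_drift_flip (x : PhaseSpace N) :
    (((P.drift N (x.1, -x.2)).1, -(P.drift N (x.1, -x.2)).2) : PhaseSpace N) =
      -P.drift N x + ((0 : Fin N → ℝ), fun i => -(2 * P.γ * bathWeight N i * x.2 i)) := by
  rw [drift_flip]
  ext i
  · simp [OscillatorChain.drift]
  · simp only [Pi.neg_apply, Prod.snd_add, Prod.neg_mk, OscillatorChain.drift, Pi.add_apply]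
    ring

/-- `∑_i w_i g_i = g_0 + g_{N-1}` (`N ≥ 1`). [folklore] -/
theorem sum_bathWeight_mul' (hN : 0 < N) (g : Fin N → ℝ) :
    ∑ i, bathWeight N i * g i = g ⟨0, hN⟩ + g ⟨N - 1, Nat.sub_lt hN one_pos⟩ := by
  simp only [bathWeight, add_mul, Finset.sum_add_distrib]
  rw [sum_ite_val_eq_mul hN 1 g, sum_ite_val_eq_mul (Nat.sub_lt hN one_pos) 1 g]
  ring

/-! ### The flip-conjugated generator -/

section FlipGenerator

variable (T_L T_R : ℝ)

/-- The momentum flip as a continuous linear map `Θ(q,p) = (q,-p)`. (Local abbreviation, spelled out in statements.)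
[folklore] -/
theorem flipCLM_apply (y : PhaseSpace N) :
    ((ContinuousLinearMap.fst ℝ (Fin N → ℝ) (Fin N → ℝ)).prod (-(ContinuousLinearMap.snd ℝ (Fin N → ℝ) (Fin N → ℝ)))) y =
      (y.1, -y.2) := rfl

/-- The flip negates the bath noise vectors: `Θ (bathVec N k c) = -bathVec N k c`. [folklore] -/
theorem flip_bathVec (k : ℕ) (c : ℝ) :
    (((bathVec N k c).1, -(bathVec N k c).2) : PhaseSpace N) = -bathVec N k c := by
  ext i <;> simp [bathVec]

/-- **The flip-conjugated generator**: for `g ∈ C²` and every chain,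
`(L(g∘Θ))(Θx) = L̂ g(x) - 2γ ∑_i w_i p_i ∂_{p_i} g(x)` with `L = sdeGenerator Y v_L v_R` (the generator of the Langevin
chain, `sdeGenerator_drift_eq_generator`) and `L̂ = sdeGenerator (-Y) v_L v_R` (anti-friction reversal).
[cite: ReyBellet2006, Lemma 4.2] -/
theorem sdeGenerator_flip_conj {g : PhaseSpace N → ℝ} (hg : ContDiff ℝ 2 g) (x : PhaseSpace N) :
    sdeGenerator (P.drift N) (P.bathVecL N T_L) (P.bathVecR N T_R) (fun y => g (y.1, -y.2)) (x.1, -x.2) =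
      sdeGenerator (fun y => -P.drift N y) (P.bathVecL N T_L) (P.bathVecR N T_R) g x -
        2 * P.γ * ∑ i, bathWeight N i * x.2 i * fderiv ℝ g x (unitP i) := by
  set A : PhaseSpace N →L[ℝ] PhaseSpace N :=
    (ContinuousLinearMap.fst ℝ (Fin N → ℝ) (Fin N → ℝ)).prod (-(ContinuousLinearMap.snd ℝ (Fin N → ℝ) (Fin N → ℝ))) with hA
  have hAy : ∀ y : PhaseSpace N, A y = (y.1, -y.2) := fun y => rfl
  have hfun : (fun y : PhaseSpace N => g (y.1, -y.2)) = fun y => g (A y) := by funext y; rw [hAy]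
  rw [hfun, sdeGenerator_comp_clm (P.drift N) _ _ A hg (x.1, -x.2)]
  have hAA : A (x.1, -x.2) = x := by rw [hAy]; simp
  have hAL : A (P.bathVecL N T_L) = -P.bathVecL N T_L := by
    rw [hAy]; exact flip_bathVec 0 _
  have hAR : A (P.bathVecR N T_R) = -P.bathVecR N T_R := by
    rw [hAy]; exact flip_bathVec (N - 1) _
  have hAY : A (P.drift N (x.1, -x.2)) = -P.drift N x + ((0 : Fin N → ℝ), fun i => -(2 * P.γ * bathWeight N i * x.2 i)) := by
    rw [hAy]; exact flip_drift_flip P x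
  rw [hAA, hAL, hAR, hAY, sdeGenerator_def]
  simp only [map_neg, neg_apply, neg_neg, map_add]
  -- the extra first-order term `Dg(x)·(0, -2γ w p)`
  have hsum : fderiv ℝ g x ((0 : Fin N → ℝ), fun i => -(2 * P.γ * bathWeight N i * x.2 i)) =
      -(2 * P.γ * ∑ i, bathWeight N i * x.2 i * fderiv ℝ g x (unitP i)) := by
    rw [clm_apply_eq_sum]
    have h0 : ∑ i : Fin N, ((0 : Fin N → ℝ), fun i => -(2 * P.γ * bathWeight N i * x.2 i)).1 i •
        fderiv ℝ g x (unitQ i) = 0 :=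
      Finset.sum_eq_zero fun i _ => by simp
    rw [h0, zero_add, Finset.mul_sum, ← Finset.sum_neg_distrib]
    refine Finset.sum_congr rfl fun i _ => ?_
    simp only [smul_eq_mul]
    ring
  rw [hsum]
  ring

end FlipGenerator

/-! ### The Doob transform of the anti-friction generator by the Gibbs density -/

section Doob

variable {P}

/-- **`L̂(ρ f) = ρ (L̂ f - 2γ ∑_i w_i p_i ∂_{p_i} f) - 2γ ρ f`** at equal bath temperatures `T > 0`, for `C²` potentials,
`N ≥ 1`, `γ ≥ 0`, `f ∈ C²`, `ρ = e^{-H/T}`: product rule `L̂(ρf) = ρ L̂f + f L̂ρ + Γ(ρ,f)` with `L̂ρ = -2γρ`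
(`revGenerator_gibbsDensity`) and the carré du champ `Γ(ρ,f) = Σ_b (Dρ·v_b)(Df·v_b) = -2γ ρ Σ_i w_i p_i ∂_{p_i} f`
(`Dρ·v_b = -(ρ/T)√(2γT) p_b`, `Df·v_b = √(2γT) ∂_{p_b} f`). [cite: ReyBellet2006, Lemma 4.2] -/
theorem revGenerator_gibbsDensity_mul (hU : ContDiff ℝ 2 P.U) (hV : ContDiff ℝ 2 P.V) (hN : 0 < N) (hγ : 0 ≤ P.γ)
    {T : ℝ} (hT : 0 < T) {f : PhaseSpace N → ℝ} (hf : ContDiff ℝ 2 f) (x : PhaseSpace N) :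
    sdeGenerator (fun y => -P.drift N y) (P.bathVecL N T) (P.bathVecR N T) (fun y => P.gibbsDensity N T y * f y) x =
      P.gibbsDensity N T x * (sdeGenerator (fun y => -P.drift N y) (P.bathVecL N T) (P.bathVecR N T) f x -
          2 * P.γ * ∑ i, bathWeight N i * x.2 i * fderiv ℝ f x (unitP i)) -
        2 * P.γ * P.gibbsDensity N T x * f x := by
  have hH2 : ContDiff ℝ 2 (P.hamiltonian N) := P.contDiff_hamiltonian hU hV N
  have hHd : Differentiable ℝ (P.hamiltonian N) := hH2.differentiable (by norm_num)
  have hρ2 : ContDiff ℝ 2 (P.gibbsDensity N T) := by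
    have : P.gibbsDensity N T = fun y => Real.exp (-P.hamiltonian N y / T) := rfl
    rw [this]; exact (hH2.neg.div_const T).exp
  rw [sdeGenerator_mul' (fun y => -P.drift N y) _ _ hρ2 hf x, revGenerator_gibbsDensity hU hV hN hγ hT x]
  -- the carré du champ
  have hF : ∀ u : ℝ, HasDerivAt (fun h => Real.exp (-h / T)) (-(1 / T) * Real.exp (-u / T)) u := fun u => by
    have h1 : HasDerivAt (fun h : ℝ => -h / T) (-1 / T) u := by
      simpa using ((hasDerivAt_id u).neg).div_const T
    exact h1.exp.congr_deriv (by ring)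
  have hDρ : ∀ v : PhaseSpace N, fderiv ℝ (P.gibbsDensity N T) x v =
      -(1 / T) * P.gibbsDensity N T x * fderiv ℝ (P.hamiltonian N) x v := by
    intro v
    have e : P.gibbsDensity N T = fun y => Real.exp (-P.hamiltonian N y / T) := rfl
    rw [e, fderiv_comp_eq_smul hF hHd]
    rfl
  have hL : fderiv ℝ (P.hamiltonian N) x (P.bathVecL N T) = Real.sqrt (2 * P.γ * T) * x.2 ⟨0, hN⟩ :=
    fderiv_hamiltonian_bathVec P hHd x hN _
  have hR : fderiv ℝ (P.hamiltonian N) x (P.bathVecR N T) =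
      Real.sqrt (2 * P.γ * T) * x.2 ⟨N - 1, Nat.sub_lt hN one_pos⟩ :=
    fderiv_hamiltonian_bathVec P hHd x (Nat.sub_lt hN one_pos) _
  have hfL : fderiv ℝ f x (P.bathVecL N T) = Real.sqrt (2 * P.γ * T) * fderiv ℝ f x (unitP ⟨0, hN⟩) := by
    show fderiv ℝ f x (bathVec N 0 (Real.sqrt (2 * P.γ * T))) = _
    rw [bathVec_eq_smul_unitP hN, map_smul, smul_eq_mul]
  have hfR : fderiv ℝ f x (P.bathVecR N T) =
      Real.sqrt (2 * P.γ * T) * fderiv ℝ f x (unitP ⟨N - 1, Nat.sub_lt hN one_pos⟩) := by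
    show fderiv ℝ f x (bathVec N (N - 1) (Real.sqrt (2 * P.γ * T))) = _
    rw [bathVec_eq_smul_unitP (Nat.sub_lt hN one_pos), map_smul, smul_eq_mul]
  have hsq : Real.sqrt (2 * P.γ * T) * Real.sqrt (2 * P.γ * T) = 2 * P.γ * T :=
    Real.mul_self_sqrt (by positivity)
  have hs : ∑ i, bathWeight N i * x.2 i * fderiv ℝ f x (unitP i) =
      x.2 ⟨0, hN⟩ * fderiv ℝ f x (unitP ⟨0, hN⟩) +
        x.2 ⟨N - 1, Nat.sub_lt hN one_pos⟩ * fderiv ℝ f x (unitP ⟨N - 1, Nat.sub_lt hN one_pos⟩) := by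
    rw [← sum_bathWeight_mul' hN (fun i => x.2 i * fderiv ℝ f x (unitP i))]
    exact Finset.sum_congr rfl fun i _ => by ring
  rw [carreDuChamp_def, hDρ, hDρ, hL, hR, hfL, hfR, hs]
  set ρx := P.gibbsDensity N T x
  set s := Real.sqrt (2 * P.γ * T)
  set a := x.2 ⟨0, hN⟩ * fderiv ℝ f x (unitP ⟨0, hN⟩)
  set b := x.2 ⟨N - 1, Nat.sub_lt hN one_pos⟩ * fderiv ℝ f x (unitP ⟨N - 1, Nat.sub_lt hN one_pos⟩)
  have hT0 : T ≠ 0 := hT.ne'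
  have key : -(1 / T) * ρx * (s * x.2 ⟨0, hN⟩) * (s * fderiv ℝ f x (unitP ⟨0, hN⟩)) +
      -(1 / T) * ρx * (s * x.2 ⟨N - 1, Nat.sub_lt hN one_pos⟩) *
        (s * fderiv ℝ f x (unitP ⟨N - 1, Nat.sub_lt hN one_pos⟩)) = -(2 * P.γ) * ρx * (a + b) := by
    have e1 : -(1 / T) * ρx * (s * x.2 ⟨0, hN⟩) * (s * fderiv ℝ f x (unitP ⟨0, hN⟩)) = -(1 / T) * (s * s) * ρx * a := by
      simp only [a]; ring
    have e2 : -(1 / T) * ρx * (s * x.2 ⟨N - 1, Nat.sub_lt hN one_pos⟩) *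
        (s * fderiv ℝ f x (unitP ⟨N - 1, Nat.sub_lt hN one_pos⟩)) = -(1 / T) * (s * s) * ρx * b := by
      simp only [b]; ring
    rw [e1, e2, hsq]
    field_simp
    ring
  linarith [key]

/-- **The Doob transform of the anti-friction generator by `e^{-H/T}` is the momentum-flipped generator**:
`ρ⁻¹ L̂(ρ f) + 2γ f = (L (f∘Θ))∘Θ` pointwise (`T_L = T_R = T > 0`, `C²` potentials, `N ≥ 1`, `γ ≥ 0`, `f ∈ C²`),
written multiplicatively to avoid division. [cite: ReyBellet2006, Lemma 4.2] -/
theorem revGenerator_gibbsDensity_mul_eq_flip (hU : ContDiff ℝ 2 P.U) (hV : ContDiff ℝ 2 P.V) (hN : 0 < N)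
    (hγ : 0 ≤ P.γ) {T : ℝ} (hT : 0 < T) {f : PhaseSpace N → ℝ} (hf : ContDiff ℝ 2 f) (x : PhaseSpace N) :
    sdeGenerator (fun y => -P.drift N y) (P.bathVecL N T) (P.bathVecR N T) (fun y => P.gibbsDensity N T y * f y) x +
        2 * P.γ * P.gibbsDensity N T x * f x =
      P.gibbsDensity N T x *
        sdeGenerator (P.drift N) (P.bathVecL N T) (P.bathVecR N T) (fun y => f (y.1, -y.2)) (x.1, -x.2) := by
  rw [revGenerator_gibbsDensity_mul hU hV hN hγ hT hf x, sdeGenerator_flip_conj P T T hf x]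
  ring

end Doob


/-! ### Dynkin's identity for the Doob transform `P̃_t f = e^{2γt} ρ⁻¹ P̂_t(ρ f)` -/

section DoobDynkin

variable {P : OscillatorChain} (hP : P.IsConfining) (hU : ContDiff ℝ 2 P.U) (hV : ContDiff ℝ 2 P.V)
  {N : ℕ} (hN : 0 < N) {T : ℝ} (hT : 0 < T)
include hP hU hV hN hT

/-- **Dynkin's identity for the Doob transform of the anti-friction kernels by the Gibbs density.** For a chain with
confining `C²` potentials, `N ≥ 1`, `T > 0` (both baths), `f ∈ C²_c` and every `t ≥ 0`, `y`:
`e^{2γt} ∫ ρ f dP̂_t(y,·) - ρ(y) f(y) = ∫₀ᵗ e^{2γs} ∫ ρ · (L(f∘Θ))∘Θ dP̂_s(y,·) ds`, i.e. the Markov semigroup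
`P̃_t f := e^{2γt}ρ⁻¹P̂_t(ρf)` satisfies Dynkin's identity on `C²_c` with the MOMENTUM-FLIPPED generator `f ↦ (L(f∘Θ))∘Θ` —
the same Dynkin data as the flipped forward semigroup `f ↦ (P_t(f∘Θ))∘Θ`. (Dynkin for `ρf ∈ C²_c` along the reversed
equation, `L̂(ρf) = ρ (L(f∘Θ))∘Θ - 2γρf`, and the integrating factor `e^{2γs}`.) Identifying the two semigroups from this
common Dynkin identity is exactly the missing uniqueness step of (H2). [cite: ReyBellet2006, Lemma 4.2] -/
theorem doob_dynkin {f : PhaseSpace N → ℝ} (hf : ContDiff ℝ 2 f) (hfc : HasCompactSupport f) (t : ℝ≥0)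
    (y : PhaseSpace N) :
    Real.exp (2 * P.γ * t) * ∫ x, P.gibbsDensity N T x * f x ∂(P.langevinRevKernel N T T t y) -
        P.gibbsDensity N T y * f y =
      ∫ s in (0 : ℝ)..t, Real.exp (2 * P.γ * s) *
        ∫ x, P.gibbsDensity N T x *
            sdeGenerator (P.drift N) (P.bathVecL N T) (P.bathVecR N T) (fun z => f (z.1, -z.2)) (x.1, -x.2)
          ∂(P.langevinRevKernel N T T s.toNNReal y) := by
  -- notation and basic facts
  set D := hP.reversedDrift N with hD
  have hv₁ := hP.bathVecL_mem_reversedDrift_noise N T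
  have hv₂ := hP.bathVecR_mem_reversedDrift_noise N T
  set κ : ℝ≥0 → Kernel (PhaseSpace N) (PhaseSpace N) := P.langevinRevKernel N T T with hκ
  have hκs : ∀ s, κ s = sdeKernel (fun y => -P.drift N y) (P.bathVecL N T) (P.bathVecR N T) s := fun s => rfl
  haveI hprob : ∀ s z, IsProbabilityMeasure (κ s z) := fun s z =>
    isProbabilityMeasure_langevinRevKernel hP N T T s z
  set ρ := P.gibbsDensity N T with hρdef
  have hH2 : ContDiff ℝ 2 (P.hamiltonian N) := P.contDiff_hamiltonian hU hV N
  have hρ2 : ContDiff ℝ 2 ρ := by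
    have : ρ = fun y => Real.exp (-P.hamiltonian N y / T) := rfl
    rw [this]; exact (hH2.neg.div_const T).exp
  have hρc : Continuous ρ := hρ2.continuous
  -- the flipped generator image and the product `g = ρ f ∈ C²_c`
  set Lf : PhaseSpace N → ℝ := fun x =>
    sdeGenerator (P.drift N) (P.bathVecL N T) (P.bathVecR N T) (fun z => f (z.1, -z.2)) (x.1, -x.2) with hLf
  set g : PhaseSpace N → ℝ := fun x => ρ x * f x with hg
  have hg2 : ContDiff ℝ 2 g := hρ2.mul hf
  have hgc : HasCompactSupport g := hfc.mul_left
  have hflipc : Continuous fun z : PhaseSpace N => ((z.1, -z.2) : PhaseSpace N) := by fun_prop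
  have hfΘ2 : ContDiff ℝ 2 fun z : PhaseSpace N => f (z.1, -z.2) := by
    have e : (fun z : PhaseSpace N => f (z.1, -z.2)) = fun z => f
        (((ContinuousLinearMap.fst ℝ (Fin N → ℝ) (Fin N → ℝ)).prod
          (-(ContinuousLinearMap.snd ℝ (Fin N → ℝ) (Fin N → ℝ)))) z) := by
      funext z; rfl
    rw [e]; exact hf.comp (ContinuousLinearMap.contDiff _)
  have hfΘc : HasCompactSupport fun z : PhaseSpace N => f (z.1, -z.2) := by
    -- the flip is a homeomorphism (an involution), so the preimage of a compact support is compact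
    refine (hfc.comp_homeomorph (Homeomorph.mk ⟨fun z : PhaseSpace N => ((z.1, -z.2) : PhaseSpace N),
      fun z => ((z.1, -z.2) : PhaseSpace N), fun z => by simp, fun z => by simp⟩ hflipc hflipc)).mono ?_
    intro z hz; exact hz
  have hYc : Continuous (P.drift N) := (hP.confinedDrift N).toConfinedDrift.contDiff_drift.continuous
  have hLfc : Continuous Lf := (continuous_sdeGenerator _ _ hYc hfΘ2).comp hflipc
  have hLfb : ∃ C, ∀ x, ‖Lf x‖ ≤ C := by
    obtain ⟨C, hC⟩ := exists_bound_sdeGenerator (P.bathVecL N T) (P.bathVecR N T) hYc hfΘ2 hfΘc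
    exact ⟨C, fun x => hC _⟩
  obtain ⟨CL, hCL⟩ := hLfb
  -- `ρ` and `ρ · Lf`, `g` are bounded continuous
  have hρ0 : ∀ x, 0 ≤ ρ x := fun x => (P.gibbsDensity_pos N T x).le
  have hρ1 : ∀ x, ρ x ≤ 1 := fun x => by
    show P.gibbsDensity N T x ≤ 1
    rw [OscillatorChain.gibbsDensity, Real.exp_le_one_iff, neg_div]
    exact neg_nonpos.2 (div_nonneg (P.hamiltonian_nonneg_of_nonneg hP.U_nonneg hP.V_nonneg N x) hT.le)
  obtain ⟨Cf, hCf⟩ : ∃ C, ∀ x, ‖f x‖ ≤ C := hf.continuous.bounded_above_of_compact_support hfc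
  have hgb : ∀ x, ‖g x‖ ≤ Cf := fun x => by
    rw [hg]; dsimp only; rw [norm_mul, Real.norm_of_nonneg (hρ0 x)]
    exact (mul_le_of_le_one_left (norm_nonneg _) (hρ1 x)).trans (hCf x)
  have hρLb : ∀ x, ‖ρ x * Lf x‖ ≤ CL := fun x => by
    rw [norm_mul, Real.norm_of_nonneg (hρ0 x)]
    exact (mul_le_of_le_one_left (norm_nonneg _) (hρ1 x)).trans (hCL x)
  -- the pointwise generator identity `L̂ g = ρ Lf - 2γ g`
  have hLg : ∀ x, sdeGenerator (fun y => -P.drift N y) (P.bathVecL N T) (P.bathVecR N T) g x = ρ x * Lf x - 2 * P.γ * g x := by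
    intro x
    have := revGenerator_gibbsDensity_mul_eq_flip hU hV hN hP.γ_nonneg hT hf x
    simp only [hg, hLf]
    linarith
  -- the three time functions
  set φ : ℝ → ℝ := fun s => ∫ x, g x ∂(κ s.toNNReal y) with hφ
  set χ : ℝ → ℝ := fun s => ∫ x, ρ x * Lf x ∂(κ s.toNNReal y) with hχ
  have hφc : Continuous φ := continuous_integral_langevinRevKernel hP N T T y hg2.continuous hgb
  have hχc : Continuous χ := continuous_integral_langevinRevKernel hP N T T y (hρc.mul hLfc) hρLb
  -- Dynkin for `g` along the reversed equation: `φ u - g y = ∫₀ᵘ (χ - 2γ φ)` for `u ≥ 0`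
  have hdyn : ∀ u : ℝ, 0 ≤ u → φ u - g y = ∫ s in (0:ℝ)..u, (χ s - 2 * P.γ * φ s) := by
    intro u hu
    have h := D.sdeKernel_dynkin hv₁ hv₂ hg2 hgc u.toNNReal y
    rw [Real.coe_toNNReal _ hu, ← hκs] at h
    simp only [hφ, hχ]
    rw [h]
    refine intervalIntegral.integral_congr fun s _ => ?_
    rw [← hκs]
    have hi1 : Integrable (fun x => ρ x * Lf x) (κ s.toNNReal y) :=
      (integrable_const CL).mono' (hρc.mul hLfc).aestronglyMeasurable (Eventually.of_forall hρLb)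
    have hi2 : Integrable g (κ s.toNNReal y) :=
      (integrable_const Cf).mono' hg2.continuous.aestronglyMeasurable (Eventually.of_forall hgb)
    have e : (fun x => sdeGenerator (fun y => -P.drift N y) (P.bathVecL N T) (P.bathVecR N T) g x) =
        fun x => ρ x * Lf x - 2 * P.γ * g x := funext hLg
    show ∫ x, sdeGenerator (fun y => -P.drift N y) (P.bathVecL N T) (P.bathVecR N T) g x ∂(κ s.toNNReal y) =
      (∫ x, ρ x * Lf x ∂(κ s.toNNReal y)) - 2 * P.γ * ∫ x, g x ∂(κ s.toNNReal y)
    rw [e, integral_sub hi1 (hi2.const_mul _), integral_const_mul]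
  -- the integrating factor: `e^{2γs} φ(s)` has derivative `e^{2γs} χ(s)` on `(0, t)`
  set Φ : ℝ → ℝ := fun s => Real.exp (2 * P.γ * s) * φ s with hΦ
  have hΦc : Continuous Φ := (Real.continuous_exp.comp (continuous_const.mul continuous_id)).mul hφc
  have hderiv : ∀ x ∈ Ioo (0:ℝ) t, HasDerivAt Φ (Real.exp (2 * P.γ * x) * χ x) x := by
    intro x hx
    have hx0 : 0 < x := hx.1
    -- `φ` agrees near `x` with the C¹ function `s ↦ g y + ∫₀ˢ (χ - 2γ φ)`
    have hΨ : HasDerivAt (fun s => g y + ∫ r in (0:ℝ)..s, (χ r - 2 * P.γ * φ r)) (χ x - 2 * P.γ * φ x) x := by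
      have hc : Continuous fun r => χ r - 2 * P.γ * φ r := hχc.sub (continuous_const.mul hφc)
      exact (hc.integral_hasStrictDerivAt 0 x).hasDerivAt.const_add (g y)
    have hφd : HasDerivAt φ (χ x - 2 * P.γ * φ x) x := by
      refine hΨ.congr_of_eventuallyEq ?_
      filter_upwards [Ioi_mem_nhds hx0] with s hs
      have := hdyn s (le_of_lt hs)
      show φ s = g y + ∫ r in (0:ℝ)..s, (χ r - 2 * P.γ * φ r)
      linarith
    have hexp : HasDerivAt (fun s => Real.exp (2 * P.γ * s)) (Real.exp (2 * P.γ * x) * (2 * P.γ)) x := by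
      have h1 : HasDerivAt (fun s : ℝ => 2 * P.γ * s) (2 * P.γ) x := by
        simpa using (hasDerivAt_id x).const_mul (2 * P.γ)
      exact h1.exp
    have := hexp.mul hφd
    refine this.congr_deriv ?_
    ring
  have hFTC := intervalIntegral.integral_eq_sub_of_hasDerivAt_of_le t.coe_nonneg hΦc.continuousOn hderiv
    (((Real.continuous_exp.comp (continuous_const.mul continuous_id)).mul hχc).intervalIntegrable _ _)
  -- assemble
  have hΦ0 : Φ 0 = g y := by
    have h0 : φ 0 = g y := sub_eq_zero.1 (by simpa using hdyn 0 le_rfl)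
    simp [hΦ, h0]
  have hΦt : Φ t = Real.exp (2 * P.γ * t) * ∫ x, g x ∂(κ t y) := by
    simp only [hΦ, hφ, Real.toNNReal_coe]
  rw [hΦt, hΦ0] at hFTC
  simp only [hg] at hFTC
  rw [← hFTC]

end DoobDynkin


/-- **Registered sub-goal `pinnedChain_doob_dynkin`** of crux stmt-AtomisticToContinuum-9120 (under `stub_kernelDetailedBalance`):
the Doob–Dynkin identity for the pinned anharmonic chain (`ω₂ > 0`, `lam, β, γ ≥ 0`, `N ≥ 1`, `T > 0`).
[cite: ReyBellet2006, Lemma 4.2] -/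
theorem pinnedChain_doob_dynkin :
    ∀ ω₂ lam β γ : ℝ, 0 < ω₂ → 0 ≤ lam → 0 ≤ β → 0 ≤ γ → ∀ T : ℝ, 0 < T → ∀ (N : ℕ), 0 < N → ∀ (f : PhaseSpace N → ℝ), ContDiff ℝ 2 f → HasCompactSupport f → ∀ (t : NNReal) (y : PhaseSpace N), Real.exp (2 * γ * t) * ∫ x, (pinnedChain ω₂ lam β γ).gibbsDensity N T x * f x ∂((pinnedChain ω₂ lam β γ).langevinRevKernel N T T t y) - (pinnedChain ω₂ lam β γ).gibbsDensity N T y * f y = ∫ s in (0 : ℝ)..t, Real.exp (2 * γ * s) * ∫ x, (pinnedChain ω₂ lam β γ).gibbsDensity N T x * sdeGenerator ((pinnedChain ω₂ lam β γ).drift N) ((pinnedChain ω₂ lam β γ).bathVecL N T) ((pinnedChain ω₂ lam β γ).bathVecR N T) (fun z => f (z.1, -z.2)) (x.1, -x.2) ∂((pinnedChain ω₂ lam β γ).langevinRevKernel N T T s.toNNReal y) :=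
  fun ω₂ lam β γ hω hl hβ hγ _ hT _ hN _ hf hfc t y =>
    doob_dynkin (pinnedChain_isConfining hω hl hβ hγ) (pinnedChain_contDiff_U ω₂ lam β γ)
      (pinnedChain_contDiff_V ω₂ lam β γ) hN hT hf hfc t y

end Summit.AtomisticToContinuum.FouriersLaw.Theorems.SubdiffusiveBondHeat

end
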